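import Literature.Analysis.FunctionSpaces.TorusEnstrophyOrthogonality

/-!
# Route `WazewskiBlock`, support item `PlanarGalerkinNoTrap` (stmt-AnomalousDissipation-10356):
# the orthogonality `b(u, u, Δu) = 0` for planar, vertically invariant fields on `𝕋³`

Helper file for the proof of
`Summit.AnomalousDissipation.AnomalousDissipation.Theses.WazewskiBlock.PlanarGalerkinNoTrap`
(the two-dimensional Alexakis–Doering mechanism at Galerkin level). The enstrophy identity of a
Galerkin trajectory (`Literature.Analysis.FluidPDE.hasDerivWithinAt_enstrophy`, every dimension)
carries the cubic "vortex stretching" term `∫ ⟪Δu, (u·∇)u⟫`; on `𝕋²` it vanishes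
(Foias–Manley–Rosa–Temam 2001, App. II.A (A.62); in the tree
`Torus.integral_inner_laplacian_convect_self_eq_zero`). This file proves the same vanishing on
`𝕋³` for the fields of the item: smooth divergence-free `u : 𝕋³ → ℝ³` that are **planar**
(`u x 2 = 0`) and **invariant under vertical translations** (`u (x + s e₂) = u x`):

* `partialDeriv_eq_zero_of_vadd_invariant` — vertical invariance kills `∂₂`;
* `partialDeriv_apply_two_eq_zero` — planarity kills the third component of every `∂ₘu`;
* `sum_apply_mul_inner_eq_zero_of_planar` — the cubic term `∑ₘ ∑ᵢ (∂ₘu)ᵢ ⟪∂ₘu, ∂ᵢu⟫` then reduces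
  to the traceless `2 × 2` computation of the tree (`tr (M Mᵀ Mᵀ) = 0`, Cayley–Hamilton);
* `integral_inner_laplacian_convect_self_eq_zero_of_planar` — hence `∫ ⟪Δu, (u·∇)u⟫ = 0`, from
  the tree's every-dimension identity `Torus.integral_inner_laplacian_convect_self_eq_neg`.

References: C. Foias, O. Manley, R. Rosa, R. Temam, *Navier–Stokes Equations and Turbulence*,
CUP 2001, App. II.A (A.62); A. Alexakis, C. R. Doering, Phys. Lett. A 359 (2006), §2.
-/

-- `Summit.<Summit>.<Problem>` is the tree's mandated summit-side namespace (CONVENTIONS §2); for this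
-- single-conjunct summit the two coincide, so the duplicate is deliberate.
set_option linter.dupNamespace false

noncomputable section

open MeasureTheory Set
open scoped InnerProductSpace

namespace Summit.AnomalousDissipation.AnomalousDissipation.Theorems.WazewskiBlock.PlanarGalerkinNoTrap

open Literature.Analysis.FunctionSpaces Literature.Analysis.FunctionSpaces.Torus

/-- The covering map sends the vertical segment `t e₂ ∈ ℝ³` to the vertical translate
`(0, 0, t mod 1)` of the origin of the three-torus. [folklore] -/
theorem proj_smul_single_two (t : ℝ) :
    proj (t • EuclideanSpace.single (2 : Fin 3) (1 : ℝ)) =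
      Pi.single (2 : Fin 3) ((t : ℝ) : UnitAddCircle) := by
  funext i
  rw [proj_apply, PiLp.smul_apply, PiLp.single_apply, Pi.single_apply]
  by_cases hi : i = 2
  · subst hi; simp
  · simp [hi]

variable {F : Type*} [NormedAddCommGroup F] [NormedSpace ℝ F]

/-- **Vertical invariance kills the vertical derivative**: if `u (x + s e₂) = u x` for every
`s ∈ ℝ/ℤ`, then `∂₂ u = 0` (the function differentiated in the definition of `∂₂` is constant).
[folklore] -/
theorem partialDeriv_eq_zero_of_vadd_invariant {u : UnitAddTorus (Fin 3) → F}
    (hinv : ∀ (s : UnitAddCircle) (x : UnitAddTorus (Fin 3)), u (x + Pi.single (2 : Fin 3) s) = u x)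
    (x : UnitAddTorus (Fin 3)) :
    partialDeriv 2 u x = 0 := by
  unfold partialDeriv Torus.lineDeriv
  have h : (fun t : ℝ => u (x + proj (t • EuclideanSpace.single (2 : Fin 3) (1 : ℝ)))) =
      fun _ => u x := by
    funext t
    rw [proj_smul_single_two, hinv]
  rw [h, deriv_const]

/-- The partial derivatives of a constant vanish. [folklore] -/
theorem partialDeriv_const' (c : F) (m : Fin 3) (x : UnitAddTorus (Fin 3)) :
    partialDeriv m (fun _ : UnitAddTorus (Fin 3) => c) x = 0 := by
  unfold partialDeriv Torus.lineDeriv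
  exact deriv_const (0 : ℝ) c

/-- **Planarity kills the third component of every partial derivative**: if `u x 2 = 0` for all
`x`, then `(∂ₘ u (x))₂ = ∂ₘ (u·)₂ (x) = 0` for a `C¹` field. [folklore] -/
theorem partialDeriv_apply_two_eq_zero {u : UnitAddTorus (Fin 3) → EuclideanSpace ℝ (Fin 3)}
    (hu : IsContDiff 1 u) (hpl : ∀ x, u x 2 = 0) (m : Fin 3) (x : UnitAddTorus (Fin 3)) :
    partialDeriv m u x 2 = 0 := by
  rw [← partialDeriv_apply_coord hu m x 2]
  have h : (fun y => u y 2) = fun _ => (0 : ℝ) := funext hpl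
  rw [h]
  exact partialDeriv_const' (0 : ℝ) m x

/-- **The cubic term vanishes for planar gradients.** For `R₀, R₁, R₂ ∈ ℝ³` (the rows `∂ₘu` of
the Jacobian) with `R₂ = 0` (vertical invariance), `(Rₘ)₂ = 0` (planarity) and `(R₀)₀ + (R₁)₁ = 0`
(incompressibility), `∑ₘ ∑ᵢ (Rₘ)ᵢ ⟪Rₘ, Rᵢ⟫ = 0`: everything reduces to the traceless `2 × 2` block,
where `tr (M Mᵀ Mᵀ) = -det M · tr M = 0` (Cayley–Hamilton; the tree's
`Torus.sum_apply_mul_inner_eq_zero_of_fin_two`). [folklore] -/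
theorem sum_apply_mul_inner_eq_zero_of_planar (R : Fin 3 → EuclideanSpace ℝ (Fin 3))
    (h2 : R 2 = 0) (hc : ∀ m, R m 2 = 0) (htr : R 0 0 + R 1 1 = 0) :
    ∑ m, ∑ i, R m i * ⟪R m, R i⟫_ℝ = 0 := by
  have h1 : R 1 1 = -R 0 0 := by linarith
  have h20 : R 2 0 = 0 := by rw [h2]; rfl
  have h21 : R 2 1 = 0 := by rw [h2]; rfl
  simp only [Fin.sum_univ_three, EuclideanSpace.inner_eq_star_dotProduct, star_trivial,
    dotProduct, hc, h20, h21, h1]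
  ring

/-- The cubic term vanishes pointwise for a `C¹` divergence-free planar vertically invariant field
on the three-torus. [folklore] -/
theorem sum_partialDeriv_mul_inner_eq_zero_of_planar
    {u : UnitAddTorus (Fin 3) → EuclideanSpace ℝ (Fin 3)} (hu : IsContDiff 1 u)
    (hdiv : IsDivFree u) (hpl : ∀ x, u x 2 = 0)
    (hinv : ∀ (s : UnitAddCircle) (x : UnitAddTorus (Fin 3)), u (x + Pi.single (2 : Fin 3) s) = u x)
    (x : UnitAddTorus (Fin 3)) :
    ∑ m, ∑ i, partialDeriv m u x i * ⟪partialDeriv m u x, partialDeriv i u x⟫_ℝ = 0 := by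
  refine sum_apply_mul_inner_eq_zero_of_planar (fun m => partialDeriv m u x)
    (partialDeriv_eq_zero_of_vadd_invariant hinv x)
    (fun m => partialDeriv_apply_two_eq_zero hu hpl m x) ?_
  have h := hdiv x
  rw [divergence_eq_sum_partialDeriv_apply hu x, Fin.sum_univ_three,
    partialDeriv_apply_two_eq_zero hu hpl 2 x, add_zero] at h
  exact h

/-- **`b(u, u, Δu) = 0` for planar vertically invariant flows on the three-torus.** For a smooth
divergence-free vector field `u : 𝕋³ → ℝ³` with `u₂ ≡ 0` and `u (x + s e₂) = u x` for all `s`,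
`∫ ⟪Δu, (u·∇)u⟫ = 0` — the two-dimensional orthogonality (A.62) of Foias–Manley–Rosa–Temam 2001
transported to the planar, `x₂`-independent fields of `𝕋³` (the every-dimension identity
`∫ ⟪Δu, (u·∇)u⟫ = -∫ ∑ₘ ∑ᵢ (∂ₘu)ᵢ ⟪∂ₘu, ∂ᵢu⟫` of the tree, whose integrand vanishes pointwise
here). [folklore] -/
theorem integral_inner_laplacian_convect_self_eq_zero_of_planar
    {u : UnitAddTorus (Fin 3) → EuclideanSpace ℝ (Fin 3)} (hu : IsSmooth u)
    (hdiv : IsDivFree u) (hpl : ∀ x, u x 2 = 0)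
    (hinv : ∀ (s : UnitAddCircle) (x : UnitAddTorus (Fin 3)), u (x + Pi.single (2 : Fin 3) s) = u x) :
    ∫ x, ⟪Torus.laplacian u x, convect u u x⟫_ℝ = 0 := by
  have hu1 : IsContDiff 1 u := hu.isContDiff (by simp)
  have h0 : ∀ x,
      ∑ m, ∑ i, partialDeriv m u x i * ⟪partialDeriv m u x, partialDeriv i u x⟫_ℝ = 0 :=
    fun x => sum_partialDeriv_mul_inner_eq_zero_of_planar hu1 hdiv hpl hinv x
  rw [integral_inner_laplacian_convect_self_eq_neg hu hdiv]
  simp_rw [h0]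
  simp

end Summit.AnomalousDissipation.AnomalousDissipation.Theorems.WazewskiBlock.PlanarGalerkinNoTrap

end
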